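import Literature.MathematicalPhysics.QuantumLattice.HubbardTorusTwoPointSmallCoupling
import Literature.Analysis.Complex.BoundedAnalyticFamilyLimit
import HarnessLib

/-!
# Cauchy estimates for the truncated coefficients `t_j(L)` from an analytic extension of the two-point function

Topic `MathematicalPhysics/QuantumLattice`; programme under the tree's fact `bgm_two_point_limit`
(`HubbardFermiLiquid.lean`) and the reduction `HubbardTwoPointLimitReduction.tendsto_hubbardThermalTwoPoint_of_truncated_bounds`
(hypothesis (A): a geometric bound `‖t_j(L)‖ ≤ C/rʲ` on the linked-cluster coefficients of the torus two-point function,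
uniform in the volume).  The renormalisation group delivers (A) in the form of a volume-uniform domain of ANALYTICITY
in the coupling (Benfatto–Giuliani–Mastropietro 2006, remark after Thm. 2.1: bounds uniform in `L` at fixed `β` for complex
`|U| ≤ U₀`).  This file is the dictionary between the two currencies:

* `truncatedSeries_radius_pos`, `truncatedSeries_ofReal_eq` — for `L ≥ 3` the truncated series `P_L(U) = Σ_j t_j(L) Uʲ`
  (the scalar formal power series `FormalMultilinearSeries.ofScalars ℂ (t_·(L))`) has positive radius (the single-scale
  radius of `exists_norm_hubbardTorusTruncatedCoeff_le_geometric`) and sums to the two-point function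
  `⟨c†_{xσ}c_{yσ'}⟩_{β,L,U,μ}` at small REAL `U`;
* **`norm_hubbardTorusTruncatedCoeff_le_of_extension`** — if some `G`, complex-differentiable on the open disc `|U| < R`
  and continuous on its closure, bounded by `M` on the circle `|U| = R`, agrees with the real two-point function
  `U ↦ hubbardThermalTwoPoint β U μ L x y σ σ'` for all small real `U`, then `‖t_j(L)‖ ≤ M / Rʲ` for every `j`
  (identity theorem on the small disc + Cauchy's estimate `Literature.Analysis.Complex.norm_inv_factorial_smul_iteratedDeriv_le`);
* `truncatedCoeff_bound_of_extension` — the same packaged in the `∀ᶠ L` shape of hypothesis (A).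

Everything is PROVED; no definition, no named fact.

## References

* G. Benfatto, A. Giuliani, V. Mastropietro, Ann. Henri Poincaré 7 (2006) 809–898, Thm. 2.1 and the remark following it,
  §2.2 (2.14)–(2.16). [BenfattoGiulianiMastropietro2006]
-/

noncomputable section

open Filter Metric Complex Set
open scoped Topology Nat NNReal ENNReal
open Literature.Probability.LatticeModels

namespace Literature.MathematicalPhysics.QuantumLattice

variable {β : ℝ} (μ : ℝ) {L : ℕ} (x y : Site 2) (σ σ' : Fin 2)

/-- **The truncated series has positive radius** (`L ≥ 3`, `β ≥ 0`): from the volume-uniform single-scale bound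
`‖t_j(L)‖ ≤ A / rʲ`. [cite: BenfattoGiulianiMastropietro2006, (2.77)] -/
theorem truncatedSeries_radius_pos (hβ : 0 ≤ β) (hL : 3 ≤ L) :
    0 < (FormalMultilinearSeries.ofScalars ℂ (hubbardTorusTruncatedCoeff β μ L x y σ σ')).radius := by
  obtain ⟨r, hr, A, hA0, hA⟩ := exists_norm_hubbardTorusTruncatedCoeff_le_geometric (β := β) (μ := μ) hβ
  have hle : ((Real.toNNReal r : ℝ≥0) : ℝ≥0∞) ≤
      (FormalMultilinearSeries.ofScalars ℂ (hubbardTorusTruncatedCoeff β μ L x y σ σ')).radius := by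
    refine FormalMultilinearSeries.le_radius_of_bound _ A fun j => ?_
    rw [FormalMultilinearSeries.ofScalars_norm, Real.coe_toNNReal _ hr.le]
    have h := hA L hL x y σ σ' j
    rw [le_div_iff₀ (pow_pos hr j)] at h
    exact h
  have hr'pos : (0 : ℝ≥0∞) < (Real.toNNReal r : ℝ≥0) := by
    rw [ENNReal.coe_pos, Real.toNNReal_pos]; exact hr
  exact lt_of_lt_of_le hr'pos hle

/-- **At small real coupling the truncated series sums to the two-point function**: there is `ρ > 0` with
`(ofScalars ℂ t(L)).sum U = hubbardThermalTwoPoint β U μ L x y σ σ'` for all real `|U| < ρ` (`L ≥ 3`, `β ≥ 0`;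
the linked-cluster theorem `hubbardThermalTwoPoint_eq_tsum_truncated` under the single-scale summability).
[cite: BenfattoGiulianiMastropietro2006, §2.2 (2.14)-(2.16)] -/
theorem truncatedSeries_ofReal_eq (hβ : 0 ≤ β) (hL : 3 ≤ L) :
    ∃ ρ : ℝ, 0 < ρ ∧ ∀ U : ℝ, |U| < ρ →
      (FormalMultilinearSeries.ofScalars ℂ (hubbardTorusTruncatedCoeff β μ L x y σ σ')).sum (U : ℂ) =
        hubbardThermalTwoPoint β U μ L x y σ σ' := by
  obtain ⟨r, hr, A, hA0, hA⟩ := exists_norm_hubbardTorusTruncatedCoeff_le_geometric (β := β) (μ := μ) hβ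
  haveI : NeZero L := ⟨by omega⟩
  refine ⟨r, hr, fun U hU => ?_⟩
  have hq0 : 0 ≤ |U| / r := div_nonneg (abs_nonneg U) hr.le
  have hq : |U| / r < 1 := (div_lt_one hr).2 hU
  -- summability of `‖U^j t_j‖ ≤ A (|U|/r)^j`
  have hs : Summable fun j : ℕ => ‖(U : ℂ) ^ j *
      hubbardTruncatedCoeff (fermionTorusGraph 2 L) β 1 μ (FermionTorus.ofTorusSite (Torus.proj L x))
        (FermionTorus.ofTorusSite (Torus.proj L y)) σ σ' j‖ := by
    refine Summable.of_nonneg_of_le (fun _ => norm_nonneg _) (fun j => ?_)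
      ((summable_geometric_of_lt_one hq0 hq).mul_left A)
    rw [← hubbardTorusTruncatedCoeff_of_neZero, norm_mul, norm_pow, Complex.norm_real, Real.norm_eq_abs, div_pow]
    calc |U| ^ j * ‖hubbardTorusTruncatedCoeff β μ L x y σ σ' j‖
        ≤ |U| ^ j * (A / r ^ j) := mul_le_mul_of_nonneg_left (hA L hL x y σ σ' j) (pow_nonneg (abs_nonneg U) j)
      _ = A * (|U| ^ j / r ^ j) := by ring
  rw [hubbardThermalTwoPoint_eq_tsum_truncated β U μ x y σ σ' hs, FormalMultilinearSeries.sum]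
  refine tsum_congr fun j => ?_
  rw [FormalMultilinearSeries.ofScalars_apply_eq, hubbardTorusTruncatedCoeff_of_neZero, smul_eq_mul,
    mul_comm]

/-- Small non-zero reals accumulate at `0` in `ℂ`: a property holding for all real `0 < |U| < ρ` holds frequently on
`𝓝[≠] 0`. [folklore] -/
private theorem frequently_nhdsWithin_ne_of_real {ρ : ℝ} (hρ : 0 < ρ) {p : ℂ → Prop}
    (h : ∀ U : ℝ, 0 < |U| → |U| < ρ → p (U : ℂ)) : ∃ᶠ w in 𝓝[≠] (0 : ℂ), p w := by
  -- the sequence `ρ/(n+2)` tends to `0` through non-zero reals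
  have ht : Tendsto (fun n : ℕ => ((ρ / ((n : ℝ) + 2) : ℝ) : ℂ)) atTop (𝓝[≠] (0 : ℂ)) := by
    refine tendsto_nhdsWithin_iff.2 ⟨?_, Eventually.of_forall fun n => ?_⟩
    · have h1 : Tendsto (fun n : ℕ => ρ / ((n : ℝ) + 2)) atTop (𝓝 0) := by
        have : Tendsto (fun n : ℕ => (n : ℝ) + 2) atTop atTop :=
          tendsto_atTop_add_const_right _ 2 tendsto_natCast_atTop_atTop
        exact this.const_div_atTop ρ
      exact (Complex.continuous_ofReal.tendsto' 0 0 Complex.ofReal_zero).comp h1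
    · have hn : (0 : ℝ) < (n : ℝ) + 2 := by positivity
      simp only [mem_compl_iff, mem_singleton_iff, Complex.ofReal_eq_zero]
      exact (div_pos hρ hn).ne'
  refine ht.frequently (Frequently.of_forall fun n => ?_)
  have hn : (0 : ℝ) < (n : ℝ) + 2 := by positivity
  have hpos : 0 < ρ / ((n : ℝ) + 2) := div_pos hρ hn
  refine h _ (by rwa [abs_of_pos hpos]) ?_
  rw [abs_of_pos hpos, div_lt_iff₀ hn]
  nlinarith

/-- **Cauchy estimate for the truncated coefficients from an analytic extension.**  Let `L ≥ 3`, `β ≥ 0`.  If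
`G : ℂ → ℂ` is complex differentiable on the open disc `|U| < R` (`R > 0`) and continuous on its closure, bounded by `M`
on the circle `|U| = R`, and coincides with the real two-point function `hubbardThermalTwoPoint β U μ L x y σ σ'` for all
real `U` with `0 < |U| < ρ` (some `ρ > 0`), then `‖t_j(L)‖ ≤ M / Rʲ` for every order `j`: the Taylor coefficients of `G`
at `0` are the `t_j(L)` (uniqueness of power series on the small disc where the linked-cluster series converges) and
Cauchy's inequality applies.  This is how a volume-uniform radius of analyticity in `U` becomes hypothesis (A) of
`tendsto_hubbardThermalTwoPoint_of_truncated_bounds`. [cite: BenfattoGiulianiMastropietro2006, Thm. 2.1 (remark)] -/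
theorem norm_hubbardTorusTruncatedCoeff_le_of_extension (hβ : 0 ≤ β) (hL : 3 ≤ L) {R M ρ : ℝ} (hR : 0 < R) (hρ : 0 < ρ)
    (G : ℂ → ℂ) (hG : DiffContOnCl ℂ G (ball 0 R)) (hM : ∀ z ∈ sphere (0 : ℂ) R, ‖G z‖ ≤ M)
    (hagree : ∀ U : ℝ, 0 < |U| → |U| < ρ → G (U : ℂ) = hubbardThermalTwoPoint β U μ L x y σ σ') (j : ℕ) :
    ‖hubbardTorusTruncatedCoeff β μ L x y σ σ' j‖ ≤ M / R ^ j := by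
  set p := FormalMultilinearSeries.ofScalars ℂ (hubbardTorusTruncatedCoeff β μ L x y σ σ') with hp
  -- the truncated series is a power series of `p.sum` at `0`
  have hP : HasFPowerSeriesAt p.sum p 0 :=
    (p.hasFPowerSeriesOnBall (truncatedSeries_radius_pos μ x y σ σ' hβ hL)).hasFPowerSeriesAt
  -- `G` is analytic at `0`
  have hGa : AnalyticAt ℂ G 0 := hG.differentiableOn.analyticAt (ball_mem_nhds 0 hR)
  -- `G = p.sum` frequently near `0` (at the small non-zero reals), hence eventually
  obtain ⟨ρ', hρ', hsum⟩ := truncatedSeries_ofReal_eq μ x y σ σ' hβ hL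
  have hfreq : ∃ᶠ w in 𝓝[≠] (0 : ℂ), G w = p.sum w := by
    refine frequently_nhdsWithin_ne_of_real (lt_min hρ hρ') fun U hU0 hU => ?_
    rw [hagree U hU0 (lt_of_lt_of_le hU (min_le_left _ _)), hp, hsum U (lt_of_lt_of_le hU (min_le_right _ _))]
  have hev : G =ᶠ[𝓝 0] p.sum := (hGa.frequently_eq_iff_eventually_eq hP.analyticAt).1 hfreq
  -- uniqueness of the power series at `0`: the Taylor coefficients of `G` are the `t_j`
  have hGp : HasFPowerSeriesAt G p 0 := hP.congr hev.symm
  have huniq := hGa.hasFPowerSeriesAt.eq_formalMultilinearSeries hGp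
  have hcoef : iteratedDeriv j G 0 / j ! = hubbardTorusTruncatedCoeff β μ L x y σ σ' j := by
    have h := congrArg (fun q : FormalMultilinearSeries ℂ ℂ ℂ => q.coeff j) huniq
    simpa [hp, FormalMultilinearSeries.coeff_ofScalars] using h
  -- Cauchy's estimate
  have hC := Literature.Analysis.Complex.norm_inv_factorial_smul_iteratedDeriv_le hR hG hM j
  rw [← hcoef, div_eq_inv_mul, ← smul_eq_mul]
  exact hC

/-- **Hypothesis (A) from a volume-uniform analytic extension**, in the `∀ᶠ L` shape consumed by
`tendsto_hubbardThermalTwoPoint_of_truncated_bounds`: if for all large `L` the real two-point function at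
`(β, μ, x, y, σ, σ')` extends to a `DiffContOnCl` function on the disc `|U| < R` bounded by `M` on `|U| = R`, then
`∀ᶠ L, ∀ j, ‖t_j(L)‖ ≤ M / Rʲ`. [cite: BenfattoGiulianiMastropietro2006, Thm. 2.1 (remark)] -/
theorem truncatedCoeff_bound_of_extension (hβ : 0 ≤ β) {R M : ℝ} (hR : 0 < R)
    (hext : ∀ᶠ L : ℕ in atTop, ∃ (G : ℂ → ℂ) (ρ : ℝ), 0 < ρ ∧ DiffContOnCl ℂ G (ball 0 R) ∧
      (∀ z ∈ sphere (0 : ℂ) R, ‖G z‖ ≤ M) ∧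
      ∀ U : ℝ, 0 < |U| → |U| < ρ → G (U : ℂ) = hubbardThermalTwoPoint β U μ L x y σ σ') :
    ∀ᶠ L : ℕ in atTop, ∀ j : ℕ, ‖hubbardTorusTruncatedCoeff β μ L x y σ σ' j‖ ≤ M / R ^ j := by
  filter_upwards [hext, eventually_ge_atTop 3] with L hL hL3 j
  obtain ⟨G, ρ, hρ, hG, hM, hagree⟩ := hL
  exact norm_hubbardTorusTruncatedCoeff_le_of_extension μ x y σ σ' hβ hL3 hR hρ G hG hM hagree j

end Literature.MathematicalPhysics.QuantumLattice

end
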